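import Literature.Topology.FourManifolds.TrisectionsStabilizationLocal
import HarnessLib

/-!
# The one-ball stabilisation and its chart (pieces for the π₁ computation, I)

Topic `Literature/Topology/FourManifolds`; infrastructure for the fact seat
`provefact-Literature.Topology.FourManifolds.exists-14560f9fc8` (named fact (c′)
`Literature.Topology.FourManifolds.exists_stabilized_gkTrisection`, Gay–Kirby 2016, Def. 8 and
Lemma 10; Abrams–Gay–Kirby 2018, Thm. 5).  Everything in this file is **proved**; no
definitions, no named facts.

First brick of the fundamental-group computation of the stabilisation (hypotheses of
`exists_marking_groupGKTrisectionOf_eq_stabilize`, `TrisectionFunctorGKStabilizationPi1.lean`):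

* `IsGKTrisection.exists_stabilization_chart` — Gay–Kirby's stabilisation performed inside a
  chart ball: a chart `Θ` of the maximal atlas at a point `x` of the central surface in which,
  on the chart domain, the central surface is the plane `{x₀ = x₃ = 0}` and the three sectors
  are the three linear wedges in `(u, v) = ((x₃ - x₀)/2, (-x₃ - x₀)/2)`, a radius `r` with
  `closedBall (Θ x) (2r) ⊆ Θ.target`, and a `(g + 3; k + 1)`-trisection `S′` equal to `S` off
  the chart ball of radius `r / 2` and whose central surface meets that ball
  (`IsGKTrisection.exists_stabilization_in`, `TrisectionsStabilizationLocal.lean`);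
* `pieces_of_agreement` — the set algebra of the decomposition `W′ = A ∪ P`, `A ∩ P ⊆ C`, … for
  any pair of subsets `W, W′` agreeing off an open `Ω₀` contained in a closed `Bc`
  (`A = W ∖ Ω₀`, `P = W′ ∩ Bc`, `C = W ∩ (Bc ∖ Ω₀)`), used for the central surfaces and for the
  three handlebodies.

## References

* D. Gay, R. Kirby, *Trisecting 4-manifolds*, Geom. Topol. 20 (2016), Def. 8 and Lemma 10.
  [GayKirby2016]
* A. Abrams, D. Gay, R. Kirby, *Group trisections and smooth 4-manifolds*, Geom. Topol. 22
  (2018), Thm. 5 and its proof (p. 1542). [AbramsGayKirby2018]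
-/

open scoped Manifold ContDiff Topology
open Set Function Filter Metric

noncomputable section

namespace Literature.Topology.FourManifolds

universe u

section Pieces

variable {X : Type u}

/-- **Set algebra of the stabilisation pieces.**  If `W′` agrees with `W` off the open set `Ω₀`
and `Ω₀ ⊆ Bc`, then with `A = W ∖ Ω₀`, `P = W′ ∩ Bc`, `C = W ∩ (Bc ∖ Ω₀)`:
`A ∪ P = W′`, `A ∩ P ⊆ C`, `C ⊆ A`, `C ⊆ P`, `A ⊆ W`. [folklore] -/
theorem pieces_of_agreement {W W' Ω₀ Bc : Set X} (hagree : ∀ y ∉ Ω₀, y ∈ W' ↔ y ∈ W)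
    (hΩB : Ω₀ ⊆ Bc) :
    (W ∩ Ω₀ᶜ) ∪ (W' ∩ Bc) = W' ∧ (W ∩ Ω₀ᶜ) ∩ (W' ∩ Bc) ⊆ W ∩ (Bc \ Ω₀) ∧
      W ∩ (Bc \ Ω₀) ⊆ W ∩ Ω₀ᶜ ∧ W ∩ (Bc \ Ω₀) ⊆ W' ∩ Bc ∧ W ∩ Ω₀ᶜ ⊆ W := by
  refine ⟨?_, ?_, ?_, ?_, inter_subset_left⟩
  · ext y
    simp only [mem_union, mem_inter_iff, mem_compl_iff]
    constructor
    · rintro (⟨hyW, hyΩ⟩ | ⟨hyW', -⟩)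
      · exact (hagree y hyΩ).2 hyW
      · exact hyW'
    · intro hyW'
      by_cases hyB : y ∈ Bc
      · exact Or.inr ⟨hyW', hyB⟩
      · have hyΩ : y ∉ Ω₀ := fun h => hyB (hΩB h)
        exact Or.inl ⟨(hagree y hyΩ).1 hyW', hyΩ⟩
  · rintro y ⟨⟨hyW, hyΩ⟩, -, hyB⟩
    exact ⟨hyW, hyB, hyΩ⟩
  · rintro y ⟨hyW, -, hyΩ⟩
    exact ⟨hyW, hyΩ⟩
  · rintro y ⟨hyW, hyB, hyΩ⟩
    exact ⟨(hagree y hyΩ).2 hyW, hyB⟩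

variable [TopologicalSpace X] [T2Space X] [CompactSpace X]
  [ChartedSpace (EuclideanSpace ℝ (Fin 4)) X] [IsManifold (𝓡 4) ∞ X]

/-- **Gay–Kirby's stabilisation inside a chart ball.**  See the module docstring.
[cite: GayKirby2016, Def. 8 and Lemma 10; AbramsGayKirby2018, proof of Thm. 5 (p. 1542)] -/
theorem IsGKTrisection.exists_stabilization_chart {g : ℕ} {k : Fin 3 → ℕ} {S : Fin 3 → Set X}
    (h : IsGKTrisection X g k S) {x : X} (hx : x ∈ ⋂ m, S m) :
    ∃ (Θ : OpenPartialHomeomorph X (EuclideanSpace ℝ (Fin 4))) (r : ℝ) (S' : Fin 3 → Set X),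
      Θ ∈ IsManifold.maximalAtlas (𝓡 4) ∞ X ∧ x ∈ Θ.source ∧ Θ x 0 = 0 ∧ Θ x 3 = 0 ∧ 0 < r ∧
      closedBall (Θ x) (2 * r) ⊆ Θ.target ∧
      -- the old trisection in the chart
      (∀ y ∈ Θ.source, y ∈ (⋂ m, S m) ↔ Θ y 0 = 0 ∧ Θ y 3 = 0) ∧
      (∀ y ∈ Θ.source, y ∈ S 0 ↔ 0 ≤ Θ y 3 - Θ y 0 ∧ 0 ≤ -Θ y 3 - Θ y 0) ∧
      (∀ y ∈ Θ.source, y ∈ S 1 ↔ Θ y 3 - Θ y 0 ≤ 0 ∧ Θ y 3 - Θ y 0 ≤ -Θ y 3 - Θ y 0) ∧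
      (∀ y ∈ Θ.source, y ∈ S 2 ↔ -Θ y 3 - Θ y 0 ≤ 0 ∧ -Θ y 3 - Θ y 0 ≤ Θ y 3 - Θ y 0) ∧
      -- the stabilised trisection
      IsGKTrisection X (g + 3) (fun m => k m + 1) S' ∧
      (∀ m, ∀ y, (y ∈ Θ.source → r / 2 ≤ ‖Θ y - Θ x‖) → (y ∈ S' m ↔ y ∈ S m)) ∧
      ((⋂ m, S' m) ∩ (Θ.source ∩ Θ ⁻¹' ball (Θ x) (r / 2))).Nonempty := by
  -- normal form and the corner chart at `x`
  obtain ⟨u, v, U, O, ρ, hT⟩ := h.exists_triNormalForm (i := 0) (j := 1) (l := 2) (by decide) (by decide) (by decide)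
  have hfr := hT.frame
  obtain ⟨C, hxC, hCO⟩ := hT.sector_i.corner x hx
  have hCU : C.Θ.source ⊆ U := hCO.trans hfr.O_subset_U
  -- the linear change `A`
  let Alin : EuclideanSpace ℝ (Fin 4) ≃ₗ[ℝ] EuclideanSpace ℝ (Fin 4) :=
    { toFun := fun y => !₂[-(y 0 + y 1), y 2, y 3, y 0 - y 1]
      invFun := fun z => !₂[(z 3 - z 0) / 2, (-z 3 - z 0) / 2, z 1, z 2]
      map_add' := fun y y' => by
        ext k; fin_cases k
        · simp; ring
        · simp
        · simp
        · simp; ring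
      map_smul' := fun r y => by
        ext k; fin_cases k
        · simp; ring
        · simp
        · simp
        · simp; ring
      left_inv := fun y => by
        ext k; fin_cases k
        · simp; ring
        · simp; ring
        · simp
        · simp
      right_inv := fun z => by
        ext k; fin_cases k
        · simp; ring
        · simp
        · simp
        · simp; ring }
  set A : EuclideanSpace ℝ (Fin 4) ≃L[ℝ] EuclideanSpace ℝ (Fin 4) := Alin.toContinuousLinearEquiv with hAdef
  have hA0 : ∀ y, A y 0 = -(y 0 + y 1) := fun y => rfl
  have hA3 : ∀ y, A y 3 = y 0 - y 1 := fun y => rfl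
  set Θ : OpenPartialHomeomorph X (EuclideanSpace ℝ (Fin 4)) := C.Θ.transHomeomorph A.toHomeomorph with hΘ
  have hΘsrc : Θ.source = C.Θ.source := OpenPartialHomeomorph.transHomeomorph_source _ _
  have hΘapply : ∀ y, Θ y = A (C.Θ y) := fun y => rfl
  have hΘmem : Θ ∈ IsManifold.maximalAtlas (𝓡 4) ∞ X := by
    rw [hΘ, OpenPartialHomeomorph.transHomeomorph_eq_trans]
    refine trans_mem_maximalAtlas C.Θ_mem_maximalAtlas (contDiffGroupoid_mem_of_contDiffOn_symm ?_ ?_)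
    · exact A.contDiff.contDiffOn
    · exact A.symm.contDiff.contDiffOn
  have hu : ∀ y ∈ Θ.source, u y = (Θ y 3 - Θ y 0) / 2 := by
    intro y hy; rw [hΘsrc] at hy
    simp only [hΘapply, hA0, hA3, C.apply_zero y hy, C.apply_one y hy]; ring
  have hv : ∀ y ∈ Θ.source, v y = (-Θ y 3 - Θ y 0) / 2 := by
    intro y hy; rw [hΘsrc] at hy
    simp only [hΘapply, hA0, hA3, C.apply_zero y hy, C.apply_one y hy]; ring
  have hxsrc : x ∈ Θ.source := by rw [hΘsrc]; exact hxC
  have hxU : x ∈ U := hfr.F_subset_U hx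
  obtain ⟨hux, hvx⟩ := (hfr.memF_iff x hxU).1 hx
  have hΘx0 : Θ x 0 = 0 := by rw [hΘapply, hA0, C.apply_zero x hxC, C.apply_one x hxC, hux, hvx]; ring
  have hΘx3 : Θ x 3 = 0 := by rw [hΘapply, hA3, C.apply_zero x hxC, C.apply_one x hxC, hux, hvx]; ring
  -- the radius
  obtain ⟨r₁, hr₁, hball⟩ := Metric.isOpen_iff.1 Θ.open_target (Θ x) (Θ.map_source hxsrc)
  set r : ℝ := r₁ / 4 with hrdef
  have hr : 0 < r := by positivity
  have hcball : closedBall (Θ x) (2 * r) ⊆ Θ.target := fun z hz => hball (by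
    rw [mem_ball]; rw [mem_closedBall] at hz; rw [hrdef] at hz; linarith)
  -- descriptions in the chart
  have hsrcU : Θ.source ⊆ U := by rw [hΘsrc]; exact hCU
  have hFdesc : ∀ y ∈ Θ.source, y ∈ (⋂ m, S m) ↔ Θ y 0 = 0 ∧ Θ y 3 = 0 := by
    intro y hy
    rw [hfr.memF_iff y (hsrcU hy), hu y hy, hv y hy]
    constructor
    · rintro ⟨h1, h2⟩; constructor <;> linarith
    · rintro ⟨h1, h2⟩; constructor <;> simp [h1, h2]
  have hS0 : ∀ y ∈ Θ.source, y ∈ S 0 ↔ 0 ≤ Θ y 3 - Θ y 0 ∧ 0 ≤ -Θ y 3 - Θ y 0 := by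
    intro y hy
    rw [hT.sector_i.mem_iff y (hsrcU hy), hu y hy, hv y hy]
    constructor <;> rintro ⟨h1, h2⟩ <;> constructor <;> linarith
  have hS1 : ∀ y ∈ Θ.source, y ∈ S 1 ↔ Θ y 3 - Θ y 0 ≤ 0 ∧ Θ y 3 - Θ y 0 ≤ -Θ y 3 - Θ y 0 := by
    intro y hy
    rw [hT.mem_j y (hsrcU hy), hu y hy, hv y hy]
    constructor <;> rintro ⟨h1, h2⟩ <;> constructor <;> linarith
  have hS2 : ∀ y ∈ Θ.source, y ∈ S 2 ↔ -Θ y 3 - Θ y 0 ≤ 0 ∧ -Θ y 3 - Θ y 0 ≤ Θ y 3 - Θ y 0 := by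
    intro y hy
    rw [hT.mem_l y (hsrcU hy), hu y hy, hv y hy]
    constructor <;> rintro ⟨h1, h2⟩ <;> constructor <;> linarith
  -- the stabilisation inside the half-radius chart ball
  set Ω₀ : Set X := Θ.source ∩ Θ ⁻¹' ball (Θ x) (r / 2) with hΩ₀
  have hΩ₀o : IsOpen Ω₀ := Θ.continuousOn.isOpen_inter_preimage Θ.open_source isOpen_ball
  have hxΩ₀ : x ∈ Ω₀ := ⟨hxsrc, mem_ball_self (by positivity)⟩
  obtain ⟨S', hS', hagree, hne⟩ := h.exists_stabilization_in hΩ₀o ⟨x, hx, hxΩ₀⟩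
  refine ⟨Θ, r, S', hΘmem, hxsrc, hΘx0, hΘx3, hr, hcball, hFdesc, hS0, hS1, hS2, hS', fun m y hy => ?_, hne⟩
  apply hagree m y
  rintro ⟨hysrc, hyball⟩
  have h1 := hy hysrc
  have h2 : dist (Θ y) (Θ x) < r / 2 := hyball
  rw [dist_eq_norm] at h2
  linarith

end Pieces

end Literature.Topology.FourManifolds
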